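import Summits.BirchSwinnertonDyer.BirchSwinnertonDyer.Theorems.PrintCf2DisegniPairTwoChiLineCharactersMinusEight
import Literature.NumberTheory.EllipticCurves.QuadraticTwistTwoLFunctionProofs
import HarnessLib

/-!
# Road (C) `disegni-pair-two` on crux stmt-BirchSwinnertonDyer-20368 — STEP A₂⁻/B₂⁻(1) on the
# `χ₋₈ ∘ N`-line at `p = 2` (`d* = −2`): Disegni's line function at every typed point equals
# `c⁻ ·` (odd-branch MTT value of `f`) `·` (odd-branch MTT value of `f′`) at the REFLECTED point `−T−2`

Cell `bsd-print-cf2`, width seat `bsd-line-cf2-p1-w8` g21; third member of the road-(C) trio after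
`…ChiLinePointwise` (`d* = 2`, `χ₈∘N`-line, plus branches, reflection `T ↦ −T−2`) and
`…ChiLinePointwiseOdd` (`d* = −1`, `χ₋₄∘N`-line, minus branches, same variable). THEOREMS ONLY (no `def`,
no named fact, no `sorry`); `--supports stmt-BirchSwinnertonDyer-20368`. BSD is not proved by any of this.
Here `ε₋₂ = χ₋₈ = χ₄χ₈` (`ZMod.χ₈'`, ODD, conductor `8`): the line through `χ₋₈∘N_{K/ℚ}` has line character
`(θχ₋₈)∘N` at `θ`, an ODD character read by Birch's odd formula on minus symbols
(`chiLineComplexPart_eq_of_isPrimitive_odd`), while on the Mazur–Tate–Teitelbaum side `θχ₋₈ = (θχ₈)·ω` is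
the odd branch `L₂⁻(g, α, ω, ·)` at the EVEN character `χ_{θχ₈}`, whose point is `−cycLinePoint ι θ − 2`:
the `χ₈`-reflection of `d* = 2` composed with the `ω`-shift of `d* = −1`.

§2 STEP A₂⁻ values (`c⁻ = ι⁻¹(−u·Car·Ω⁻_f·Ω⁻_{f′})`): `chiLineValue_chi8'_level_two` (`θ = 𝟙`: line
character `χ₋₈∘N`, `n = 2+1`), `chiLineValue_chi8'_of_level_eight` (`θ = χ₈`: line character `χ₄∘N`,
`n = 2`), `chiLineValue_chi8'_of_three_le` (`ξ = θχ₋₈` primitive odd of conductor `2^{m+1} ≥ 16`).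
§3 STEP B₂⁻(1): `hasLineValueAt_chi8'Line_zero/_neg_two/_of_three_le`.

References: Disegni 2017 Thm. A (arXiv v3 PDF pp. 6–7); Gross 2004 §3, §13 (Artin formalism);
Mazur–Tate–Teitelbaum 1986 §I.8 (8.6), §I.13–I.14; Montgomery–Vaughan 2007 §9.1.
-/

set_option autoImplicit false
set_option linter.dupNamespace false

noncomputable section

open scoped Classical MatrixGroups ModularForm NumberField

open CongruenceSubgroup NumberField IsDedekindDomain Literature.NumberTheory.EllipticCurves
  Literature.NumberTheory.EllipticCurves.ModularForms
  Literature.NumberTheory.EllipticCurves.Disegni2017 Literature.NumberTheory.GaloisRepresentations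
  Summit.BirchSwinnertonDyer.Rank1Residual.Additive

namespace Summit.BirchSwinnertonDyer.BirchSwinnertonDyer.Theorems.PrintCf2.DisegniPairTwo

/-! ### §2 `p = 2`: STEP A₂⁻ — Disegni's interpolation values on the `χ₋₈ ∘ N`-line -/

section StepAMinusEight

variable (ι : PadicAlgCl 2 ≃+* ℂ) (K : Type) [Field K] [NumberField K] [IsGalois ℚ K]

/-- ★ **STEP A₂⁻ at the base point `θ = 𝟙` of the `χ₋₈∘N`-line** (line character `χ₋₈∘N`, conductor `8`
at both places, `n = 2+1`): for entire continuations `Λ₁, Λ₂` of `L(f⊗χ₋₈, s)`, `L(f′⊗χ₋₈, s)`,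
`chiLineValue(θ = 𝟙) = c⁻ · (α⁻³Σ_b χ_{χ₋₈}(b)[b/8]⁻_f) · (α⁻³Σ_b χ_{χ₋₈}(b)[b/8]⁻_{f′})`,
`c⁻ = ι⁻¹(−u·Car·Ω⁻_f·Ω⁻_{f′})` — the two factors being the odd-branch MTT values
`L₂⁻(g, α, ω, ·)` at the character `χ_{χ₈}`, i.e. at `T = −2`. [cite: Disegni2017, Theorem A (arXiv v3 PDF pp. 6–7)]
[cite: MazurTateTeitelbaum1986Invent, §I.8 (8.6), §I.14 (14.3)] -/
theorem chiLineValue_chi8'_level_two (h2 : Module.finrank ℚ K = 2)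
    (hsplit : ((Ideal.span {(2 : ℤ)}).primesOver (𝓞 K)).ncard = 2)
    (𝔭 𝔭' : HeightOneSpectrum (𝓞 K)) (h𝔭 : ((2 : ℕ) : 𝓞 K) ∈ 𝔭.asIdeal)
    (h𝔭' : ((2 : ℕ) : 𝓞 K) ∈ 𝔭'.asIdeal)
    {N N' : ℕ} [NeZero N] [NeZero N'] {f : CuspForm (Gamma0 N) 2} {f' : CuspForm (Gamma0 N') 2}
    (hf : IsNewform0 f) (hQ : coeffField f = ⊥) (hf' : IsNewform0 f') (hQ' : coeffField f' = ⊥)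
    (α : ℚ_[2]) (Car : ℝ) (θ : DirichletCharacter ℂ (2 ^ (0 + 1))) {Λ₁ Λ₂ : ℂ → ℂ}
    (hΛ₁ : Differentiable ℂ Λ₁)
    (hΛ₁' : ∀ s : ℂ, 2 < s.re → Λ₁ s = twistedLSeries f
      (ZMod.χ₈'.ringHomComp (Int.castRingHom ℂ) : DirichletCharacter ℂ (2 ^ (2 + 1))) s)
    (hΛ₂ : Differentiable ℂ Λ₂)
    (hΛ₂' : ∀ s : ℂ, 2 < s.re → Λ₂ s = twistedLSeries f'
      (ZMod.χ₈'.ringHomComp (Int.castRingHom ℂ) : DirichletCharacter ℂ (2 ^ (2 + 1))) s) :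
    chiLineValue ι K (ι ((α : PadicAlgCl 2))) N
        (baseChangeDirichlet K (ZMod.χ₈'.ringHomComp (Int.castRingHom ℂ))) 𝔭 𝔭' θ Car (Λ₁ 1 * Λ₂ 1) =
      ((ι.symm (-(splitLocalConstant 2 : ℂ) * (Car : ℂ) * (minusPeriod f : ℂ) * (minusPeriod f' : ℂ)) :
          PadicAlgCl 2) : ℂ_[2]) *
        (algebraMap ℚ_[2] ℂ_[2] (α⁻¹ ^ (2 + 1)) *
          ratMinusTwistedSymbolSum f
            (((ZMod.χ₈'.ringHomComp (Int.castRingHom ℂ) : DirichletCharacter ℂ (2 ^ (2 + 1)))⁻¹.ringHomComp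
              ι.symm.toRingHom).ringHomComp (algebraMap (PadicAlgCl 2) ℂ_[2]))) *
        (algebraMap ℚ_[2] ℂ_[2] (α⁻¹ ^ (2 + 1)) *
          ratMinusTwistedSymbolSum f'
            (((ZMod.χ₈'.ringHomComp (Int.castRingHom ℂ) : DirichletCharacter ℂ (2 ^ (2 + 1)))⁻¹.ringHomComp
              ι.symm.toRingHom).ringHomComp (algebraMap (PadicAlgCl 2) ℂ_[2]))) := by
  rw [chiLineValue, dirichletCharacter_level_two_eq_one θ, baseChangeDirichlet_one, mul_one]
  exact chiLineComplexPart_eq_of_isPrimitive_odd ι K h2 hsplit 𝔭 𝔭' h𝔭 h𝔭' (n := 2 + 1) (by norm_num)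
    isPrimitive_χ₈'_ringHomComp chi8'_odd hf hQ hf' hQ' α Car hΛ₁ hΛ₁' hΛ₂ hΛ₂'

/-- ★ **STEP A₂⁻ at the point `θ = χ₈` of the `χ₋₈∘N`-line** (the even primitive character mod `8`):
the line character is `(χ₈χ₋₈)∘N = χ₄∘N` (conductor `4`, `n = 2`), and for entire continuations
`Λ₁, Λ₂` of `L(f⊗χ₄, s)`, `L(f′⊗χ₄, s)`:
`chiLineValue(θ) = c⁻ · (α⁻²Σ_b χ_{χ₄}(b)[b/4]⁻_f) · (α⁻²Σ_b χ_{χ₄}(b)[b/4]⁻_{f′})` — the two factors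
being the constant terms `L₂⁻(g, α, ω, 0)` (`constantCoeff_padicLFunctionMinusBranch_one_two`,
`ratMinusTwistedSymbolSum_twin_chi4`), i.e. the odd branches at `T = 0 = −(−2) − 2`, the reflection of
the point `−2` of `θ = χ₈`. [cite: Disegni2017, Theorem A (arXiv v3 PDF pp. 6–7)]
[cite: MazurTateTeitelbaum1986Invent, §I.8 (8.6), §I.14 (14.3)] -/
theorem chiLineValue_chi8'_of_level_eight (h2 : Module.finrank ℚ K = 2)
    (hsplit : ((Ideal.span {(2 : ℤ)}).primesOver (𝓞 K)).ncard = 2)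
    (𝔭 𝔭' : HeightOneSpectrum (𝓞 K)) (h𝔭 : ((2 : ℕ) : 𝓞 K) ∈ 𝔭.asIdeal)
    (h𝔭' : ((2 : ℕ) : 𝓞 K) ∈ 𝔭'.asIdeal)
    {N N' : ℕ} [NeZero N] [NeZero N'] {f : CuspForm (Gamma0 N) 2} {f' : CuspForm (Gamma0 N') 2}
    (hf : IsNewform0 f) (hQ : coeffField f = ⊥) (hf' : IsNewform0 f') (hQ' : coeffField f' = ⊥)
    (α : ℚ_[2]) (Car : ℝ) {θ : DirichletCharacter ℂ (2 ^ (2 + 1))} (heven : θ.Even)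
    (hprim : θ.IsPrimitive) {Λ₁ Λ₂ : ℂ → ℂ} (hΛ₁ : Differentiable ℂ Λ₁)
    (hΛ₁' : ∀ s : ℂ, 2 < s.re → Λ₁ s =
      twistedLSeries f (ZMod.χ₄.ringHomComp (Int.castRingHom ℂ) : DirichletCharacter ℂ (2 ^ 2)) s)
    (hΛ₂ : Differentiable ℂ Λ₂)
    (hΛ₂' : ∀ s : ℂ, 2 < s.re → Λ₂ s =
      twistedLSeries f' (ZMod.χ₄.ringHomComp (Int.castRingHom ℂ) : DirichletCharacter ℂ (2 ^ 2)) s) :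
    chiLineValue ι K (ι ((α : PadicAlgCl 2))) N
        (baseChangeDirichlet K (ZMod.χ₈'.ringHomComp (Int.castRingHom ℂ))) 𝔭 𝔭' θ Car (Λ₁ 1 * Λ₂ 1) =
      ((ι.symm (-(splitLocalConstant 2 : ℂ) * (Car : ℂ) * (minusPeriod f : ℂ) * (minusPeriod f' : ℂ)) :
          PadicAlgCl 2) : ℂ_[2]) *
        (algebraMap ℚ_[2] ℂ_[2] (α⁻¹ ^ 2) *
          ratMinusTwistedSymbolSum f
            (((ZMod.χ₄.ringHomComp (Int.castRingHom ℂ) : DirichletCharacter ℂ (2 ^ 2))⁻¹.ringHomComp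
              ι.symm.toRingHom).ringHomComp (algebraMap (PadicAlgCl 2) ℂ_[2]))) *
        (algebraMap ℚ_[2] ℂ_[2] (α⁻¹ ^ 2) *
          ratMinusTwistedSymbolSum f'
            (((ZMod.χ₄.ringHomComp (Int.castRingHom ℂ) : DirichletCharacter ℂ (2 ^ 2))⁻¹.ringHomComp
              ι.symm.toRingHom).ringHomComp (algebraMap (PadicAlgCl 2) ℂ_[2]))) := by
  rw [chiLineValue, baseChangeDirichlet_chi8'_mul_of_level_eight K heven hprim]
  exact chiLineComplexPart_eq_of_isPrimitive_odd ι K h2 hsplit 𝔭 𝔭' h𝔭 h𝔭' (n := 2) (by norm_num)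
    chi4_isPrimitive chi4_odd hf hQ hf' hQ' α Car hΛ₁ hΛ₁' hΛ₂ hΛ₂'

/-- ★ **STEP A₂⁻ at the points `θ` of level `2^{m+1} ≥ 16` of the `χ₋₈∘N`-line** (`θ` primitive and even,
`m ≥ 3`; `ξ := θχ₋₈` is primitive and ODD of conductor `2^{m+1}`): for entire continuations `Λ₁, Λ₂` of
`L(f⊗ξ, s)`, `L(f′⊗ξ, s)`,
`chiLineValue(θ) = c⁻ · (α^{−(m+1)}Σ_b χ_ξ(b)[b/2^{m+1}]⁻_f) · (α^{−(m+1)}Σ_b χ_ξ(b)[b/2^{m+1}]⁻_{f′})` — the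
two factors being the odd-branch MTT values at `χ_{θχ₈}`, i.e. at `T = −(cycLinePoint ι θ) − 2`.
[cite: Disegni2017, Theorem A (arXiv v3 PDF pp. 6–7)] [cite: MazurTateTeitelbaum1986Invent, §I.8 (8.6), §I.14 (14.3)] -/
theorem chiLineValue_chi8'_of_three_le (h2 : Module.finrank ℚ K = 2)
    (hsplit : ((Ideal.span {(2 : ℤ)}).primesOver (𝓞 K)).ncard = 2)
    (𝔭 𝔭' : HeightOneSpectrum (𝓞 K)) (h𝔭 : ((2 : ℕ) : 𝓞 K) ∈ 𝔭.asIdeal)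
    (h𝔭' : ((2 : ℕ) : 𝓞 K) ∈ 𝔭'.asIdeal)
    {N N' : ℕ} [NeZero N] [NeZero N'] {f : CuspForm (Gamma0 N) 2} {f' : CuspForm (Gamma0 N') 2}
    (hf : IsNewform0 f) (hQ : coeffField f = ⊥) (hf' : IsNewform0 f') (hQ' : coeffField f' = ⊥)
    (α : ℚ_[2]) (Car : ℝ) {m : ℕ} (hm : 3 ≤ m) (h8 : 8 ∣ 2 ^ (m + 1))
    {θ : DirichletCharacter ℂ (2 ^ (m + 1))} (heven : θ.Even) (hprim : θ.IsPrimitive)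
    {Λ₁ Λ₂ : ℂ → ℂ} (hΛ₁ : Differentiable ℂ Λ₁)
    (hΛ₁' : ∀ s : ℂ, 2 < s.re → Λ₁ s = twistedLSeries f
      (θ * DirichletCharacter.changeLevel h8 (ZMod.χ₈'.ringHomComp (Int.castRingHom ℂ))) s)
    (hΛ₂ : Differentiable ℂ Λ₂)
    (hΛ₂' : ∀ s : ℂ, 2 < s.re → Λ₂ s = twistedLSeries f'
      (θ * DirichletCharacter.changeLevel h8 (ZMod.χ₈'.ringHomComp (Int.castRingHom ℂ))) s) :
    chiLineValue ι K (ι ((α : PadicAlgCl 2))) N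
        (baseChangeDirichlet K (ZMod.χ₈'.ringHomComp (Int.castRingHom ℂ))) 𝔭 𝔭' θ Car (Λ₁ 1 * Λ₂ 1) =
      ((ι.symm (-(splitLocalConstant 2 : ℂ) * (Car : ℂ) * (minusPeriod f : ℂ) * (minusPeriod f' : ℂ)) :
          PadicAlgCl 2) : ℂ_[2]) *
        (algebraMap ℚ_[2] ℂ_[2] (α⁻¹ ^ (m + 1)) *
          ratMinusTwistedSymbolSum f
            (((θ * DirichletCharacter.changeLevel h8 (ZMod.χ₈'.ringHomComp (Int.castRingHom ℂ)))⁻¹.ringHomComp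
              ι.symm.toRingHom).ringHomComp (algebraMap (PadicAlgCl 2) ℂ_[2]))) *
        (algebraMap ℚ_[2] ℂ_[2] (α⁻¹ ^ (m + 1)) *
          ratMinusTwistedSymbolSum f'
            (((θ * DirichletCharacter.changeLevel h8 (ZMod.χ₈'.ringHomComp (Int.castRingHom ℂ)))⁻¹.ringHomComp
              ι.symm.toRingHom).ringHomComp (algebraMap (PadicAlgCl 2) ℂ_[2]))) := by
  rw [chiLineValue, baseChangeDirichlet_mul_changeLevel K h8 _ θ]
  exact chiLineComplexPart_eq_of_isPrimitive_odd ι K h2 hsplit 𝔭 𝔭' h𝔭 h𝔭' (n := m + 1) (Nat.succ_pos m)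
    (isPrimitive_mul_chi8'_changeLevel hm h8 hprim) (odd_mul_chi8'_changeLevel h8 heven) hf hQ hf' hQ' α
    Car hΛ₁ hΛ₁' hΛ₂ hΛ₂'

end StepAMinusEight

/-! ### §3 STEP B₂⁻(1): Disegni's function at the typed points of the `χ₋₈∘N`-line -/

section PointwiseMinusEight

variable (ι : PadicAlgCl 2 ≃+* ℂ) (K : Type) [Field K] [NumberField K] [IsGalois ℚ K]

/-- ★ **STEP B₂⁻(1) at `T = 0` on the `χ₋₈∘N`-line** (`K` quadratic, `(2, d_K) = 1`, `2` split,
`𝔭, 𝔭′ ∋ 2`; `f, f′` rational newforms with `a_n(f′) = κ_K(n)a_n(f)`; `α ∈ ℚ₂`, `a = ι(α)`; `G` with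
`ChiLineInterpolation` on the line through `χ₋₈∘N`):
`G(0) = c⁻ · (α⁻³Σ_b χ_{χ₋₈}(b)[b/8]⁻_f) · (α⁻³Σ_b χ_{χ₋₈}(b)[b/8]⁻_{f′})`.
[cite: Disegni2017, Theorem A (arXiv v3 PDF pp. 6–7)] [cite: Gross2004, §3, §13]
[cite: MazurTateTeitelbaum1986Invent, §I.8 (8.6), §I.14 (14.3)] -/
theorem hasLineValueAt_chi8'Line_zero (h2 : Module.finrank ℚ K = 2)
    (hsplit : ((Ideal.span {(2 : ℤ)}).primesOver (𝓞 K)).ncard = 2)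
    (𝔭 𝔭' : HeightOneSpectrum (𝓞 K)) (h𝔭 : ((2 : ℕ) : 𝓞 K) ∈ 𝔭.asIdeal)
    (h𝔭' : ((2 : ℕ) : 𝓞 K) ∈ 𝔭'.asIdeal)
    (κ : DirichletCharacter ℂ (NumberField.discr K).natAbs)
    (hκ : ∀ ℓ : ℕ, ℓ.Prime → ℓ ≠ 2 → κ ℓ = (jacobiSym (NumberField.discr K) ℓ : ℂ))
    (hκ2 : κ 2 = if NumberField.discr K % 8 = 1 then 1
        else if NumberField.discr K % 8 = 5 then -1 else 0)
    (hd : Nat.Coprime 2 (NumberField.discr K).natAbs)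
    {N N' : ℕ} [NeZero N] [NeZero N'] {f : CuspForm (Gamma0 N) 2} {f' : CuspForm (Gamma0 N') 2}
    (hf : IsNewform0 f) (hQ : coeffField f = ⊥) (hf' : IsNewform0 f') (hQ' : coeffField f' = ⊥)
    (hV' : ∀ n : ℕ, cuspCoeff f' n = κ (n : ZMod _) * cuspCoeff f n)
    (α : ℚ_[2]) {Car : ℝ} {G : PowerSeries ℂ_[2]}
    (hG : ChiLineInterpolation ι K f (ι ((α : PadicAlgCl 2)))
      (baseChangeDirichlet K (ZMod.χ₈'.ringHomComp (Int.castRingHom ℂ))) 𝔭 𝔭' Car G) :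
    HasLineValueAt G 0
      (((ι.symm (-(splitLocalConstant 2 : ℂ) * (Car : ℂ) * (minusPeriod f : ℂ) * (minusPeriod f' : ℂ)) :
          PadicAlgCl 2) : ℂ_[2]) *
        (algebraMap ℚ_[2] ℂ_[2] (α⁻¹ ^ (2 + 1)) *
          ratMinusTwistedSymbolSum f
            (((ZMod.χ₈'.ringHomComp (Int.castRingHom ℂ) : DirichletCharacter ℂ (2 ^ (2 + 1)))⁻¹.ringHomComp
              ι.symm.toRingHom).ringHomComp (algebraMap (PadicAlgCl 2) ℂ_[2]))) *
        (algebraMap ℚ_[2] ℂ_[2] (α⁻¹ ^ (2 + 1)) *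
          ratMinusTwistedSymbolSum f'
            (((ZMod.χ₈'.ringHomComp (Int.castRingHom ℂ) : DirichletCharacter ℂ (2 ^ (2 + 1)))⁻¹.ringHomComp
              ι.symm.toRingHom).ringHomComp (algebraMap (PadicAlgCl 2) ℂ_[2])))) := by
  set Ξ : DirichletCharacter ℂ (2 ^ (2 + 1)) := ZMod.χ₈'.ringHomComp (Int.castRingHom ℂ) with hΞ
  obtain ⟨Λ₁, hΛ₁, hΛ₁'⟩ := exists_differentiable_eq_twistedLSeries_holds (f := f) Ξ
  obtain ⟨Λ₂, hΛ₂, hΛ₂'⟩ := exists_differentiable_eq_twistedLSeries_holds (f := f') Ξ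
  have hΛ : Differentiable ℂ (fun s ↦ Λ₁ s * Λ₂ s) := hΛ₁.mul hΛ₂
  have hRS : ∀ s : ℂ, 2 < s.re → (fun s ↦ Λ₁ s * Λ₂ s) s =
      rankinSelbergEulerProductHecke f
        (baseChangeDirichlet K (ZMod.χ₈'.ringHomComp (Int.castRingHom ℂ)) *
          baseChangeDirichlet K (1 : DirichletCharacter ℂ (2 ^ (0 + 1)))) s := by
    intro s hs
    rw [baseChangeDirichlet_one, mul_one]
    exact rankinSelberg_baseChangeDirichlet_eq_mul K h2 κ hκ hκ2 hd hf hV' (n := 2 + 1)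
      isPrimitive_χ₈'_ringHomComp hΛ₁' hΛ₂' s hs
  have hval := hG.hasLineValueAt (θ := (1 : DirichletCharacter ℂ (2 ^ (0 + 1))))
    (MulChar.one_apply isUnit_one.neg) ⟨0, by rw [orderOf_one, pow_zero]⟩ (Or.inr rfl) hΛ hRS
  rw [cycLinePoint_one] at hval
  rwa [chiLineValue_chi8'_level_two ι K h2 hsplit 𝔭 𝔭' h𝔭 h𝔭' hf hQ hf' hQ' α Car 1 hΛ₁ hΛ₁' hΛ₂
    hΛ₂'] at hval

/-- ★ **STEP B₂⁻(1) at `T = −2` on the `χ₋₈∘N`-line** (the point `θ = χ₈`, where the line character is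
`χ₄∘N`): `G(−2) = c⁻ · (α⁻²Σ_b χ_{χ₄}(b)[b/4]⁻_f) · (α⁻²Σ_b χ_{χ₄}(b)[b/4]⁻_{f′})` — the odd branches at
`T = 0`. [cite: Disegni2017, Theorem A (arXiv v3 PDF pp. 6–7)] [cite: Gross2004, §3, §13]
[cite: MazurTateTeitelbaum1986Invent, §I.14 (14.3)] -/
theorem hasLineValueAt_chi8'Line_neg_two (h2 : Module.finrank ℚ K = 2)
    (hsplit : ((Ideal.span {(2 : ℤ)}).primesOver (𝓞 K)).ncard = 2)
    (𝔭 𝔭' : HeightOneSpectrum (𝓞 K)) (h𝔭 : ((2 : ℕ) : 𝓞 K) ∈ 𝔭.asIdeal)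
    (h𝔭' : ((2 : ℕ) : 𝓞 K) ∈ 𝔭'.asIdeal)
    (κ : DirichletCharacter ℂ (NumberField.discr K).natAbs)
    (hκ : ∀ ℓ : ℕ, ℓ.Prime → ℓ ≠ 2 → κ ℓ = (jacobiSym (NumberField.discr K) ℓ : ℂ))
    (hκ2 : κ 2 = if NumberField.discr K % 8 = 1 then 1
        else if NumberField.discr K % 8 = 5 then -1 else 0)
    (hd : Nat.Coprime 2 (NumberField.discr K).natAbs)
    {N N' : ℕ} [NeZero N] [NeZero N'] {f : CuspForm (Gamma0 N) 2} {f' : CuspForm (Gamma0 N') 2}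
    (hf : IsNewform0 f) (hQ : coeffField f = ⊥) (hf' : IsNewform0 f') (hQ' : coeffField f' = ⊥)
    (hV' : ∀ n : ℕ, cuspCoeff f' n = κ (n : ZMod _) * cuspCoeff f n)
    (α : ℚ_[2]) {Car : ℝ} {G : PowerSeries ℂ_[2]}
    (hG : ChiLineInterpolation ι K f (ι ((α : PadicAlgCl 2)))
      (baseChangeDirichlet K (ZMod.χ₈'.ringHomComp (Int.castRingHom ℂ))) 𝔭 𝔭' Car G)
    {θ : DirichletCharacter ℂ (2 ^ (2 + 1))} (heven : θ.Even) (hprim : θ.IsPrimitive) :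
    HasLineValueAt G (-2)
      (((ι.symm (-(splitLocalConstant 2 : ℂ) * (Car : ℂ) * (minusPeriod f : ℂ) * (minusPeriod f' : ℂ)) :
          PadicAlgCl 2) : ℂ_[2]) *
        (algebraMap ℚ_[2] ℂ_[2] (α⁻¹ ^ 2) *
          ratMinusTwistedSymbolSum f
            (((ZMod.χ₄.ringHomComp (Int.castRingHom ℂ) : DirichletCharacter ℂ (2 ^ 2))⁻¹.ringHomComp
              ι.symm.toRingHom).ringHomComp (algebraMap (PadicAlgCl 2) ℂ_[2]))) *
        (algebraMap ℚ_[2] ℂ_[2] (α⁻¹ ^ 2) *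
          ratMinusTwistedSymbolSum f'
            (((ZMod.χ₄.ringHomComp (Int.castRingHom ℂ) : DirichletCharacter ℂ (2 ^ 2))⁻¹.ringHomComp
              ι.symm.toRingHom).ringHomComp (algebraMap (PadicAlgCl 2) ℂ_[2])))) := by
  set χ₄₂ : DirichletCharacter ℂ (2 ^ 2) := ZMod.χ₄.ringHomComp (Int.castRingHom ℂ) with hχ₄₂
  obtain ⟨Λ₁, hΛ₁, hΛ₁'⟩ := exists_differentiable_eq_twistedLSeries_holds (f := f) χ₄₂
  obtain ⟨Λ₂, hΛ₂, hΛ₂'⟩ := exists_differentiable_eq_twistedLSeries_holds (f := f') χ₄₂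
  have hΛ : Differentiable ℂ (fun s ↦ Λ₁ s * Λ₂ s) := hΛ₁.mul hΛ₂
  have hRS : ∀ s : ℂ, 2 < s.re → (fun s ↦ Λ₁ s * Λ₂ s) s =
      rankinSelbergEulerProductHecke f
        (baseChangeDirichlet K (ZMod.χ₈'.ringHomComp (Int.castRingHom ℂ)) * baseChangeDirichlet K θ) s := by
    intro s hs
    rw [baseChangeDirichlet_chi8'_mul_of_level_eight K heven hprim]
    exact rankinSelberg_baseChangeDirichlet_eq_mul K h2 κ hκ hκ2 hd hf hV' chi4_isPrimitive hΛ₁' hΛ₂' s hs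
  have hval := hG.hasLineValueAt (θ := θ) heven (exists_orderOf_eq_two_pow θ) (Or.inl hprim) hΛ hRS
  rw [show cycLinePoint ι θ = -2 by
    rw [eq_chi8_of_even_of_isPrimitive θ heven hprim]; exact cycLinePoint_chi8 ι] at hval
  rwa [chiLineValue_chi8'_of_level_eight ι K h2 hsplit 𝔭 𝔭' h𝔭 h𝔭' hf hQ hf' hQ' α Car heven hprim hΛ₁
    hΛ₁' hΛ₂ hΛ₂'] at hval

/-- ★ **STEP B₂⁻(1) at the points of level `2^{m+1} ≥ 16` of the `χ₋₈∘N`-line** (`θ` primitive and even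
mod `2^{m+1}`, `m ≥ 3`, `ξ = θχ₋₈`): `G(cycLinePoint ι θ) = c⁻ · (α^{−(m+1)}Σ_b χ_ξ(b)[b/2^{m+1}]⁻_f) ·
(α^{−(m+1)}Σ_b χ_ξ(b)[b/2^{m+1}]⁻_{f′})` — the odd-branch MTT values at `χ_{θχ₈}`, point
`−(cycLinePoint ι θ) − 2`. [cite: Disegni2017, Theorem A (arXiv v3 PDF pp. 6–7)] [cite: Gross2004, §3, §13]
[cite: MazurTateTeitelbaum1986Invent, §I.8 (8.6), §I.14 (14.3)] -/
theorem hasLineValueAt_chi8'Line_of_three_le (h2 : Module.finrank ℚ K = 2)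
    (hsplit : ((Ideal.span {(2 : ℤ)}).primesOver (𝓞 K)).ncard = 2)
    (𝔭 𝔭' : HeightOneSpectrum (𝓞 K)) (h𝔭 : ((2 : ℕ) : 𝓞 K) ∈ 𝔭.asIdeal)
    (h𝔭' : ((2 : ℕ) : 𝓞 K) ∈ 𝔭'.asIdeal)
    (κ : DirichletCharacter ℂ (NumberField.discr K).natAbs)
    (hκ : ∀ ℓ : ℕ, ℓ.Prime → ℓ ≠ 2 → κ ℓ = (jacobiSym (NumberField.discr K) ℓ : ℂ))
    (hκ2 : κ 2 = if NumberField.discr K % 8 = 1 then 1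
        else if NumberField.discr K % 8 = 5 then -1 else 0)
    (hd : Nat.Coprime 2 (NumberField.discr K).natAbs)
    {N N' : ℕ} [NeZero N] [NeZero N'] {f : CuspForm (Gamma0 N) 2} {f' : CuspForm (Gamma0 N') 2}
    (hf : IsNewform0 f) (hQ : coeffField f = ⊥) (hf' : IsNewform0 f') (hQ' : coeffField f' = ⊥)
    (hV' : ∀ n : ℕ, cuspCoeff f' n = κ (n : ZMod _) * cuspCoeff f n)
    (α : ℚ_[2]) {Car : ℝ} {G : PowerSeries ℂ_[2]}
    (hG : ChiLineInterpolation ι K f (ι ((α : PadicAlgCl 2)))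
      (baseChangeDirichlet K (ZMod.χ₈'.ringHomComp (Int.castRingHom ℂ))) 𝔭 𝔭' Car G)
    {m : ℕ} (hm : 3 ≤ m) (h8 : 8 ∣ 2 ^ (m + 1)) {θ : DirichletCharacter ℂ (2 ^ (m + 1))}
    (heven : θ.Even) (hprim : θ.IsPrimitive) :
    HasLineValueAt G (cycLinePoint ι θ)
      (((ι.symm (-(splitLocalConstant 2 : ℂ) * (Car : ℂ) * (minusPeriod f : ℂ) * (minusPeriod f' : ℂ)) :
          PadicAlgCl 2) : ℂ_[2]) *
        (algebraMap ℚ_[2] ℂ_[2] (α⁻¹ ^ (m + 1)) *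
          ratMinusTwistedSymbolSum f
            (((θ * DirichletCharacter.changeLevel h8 (ZMod.χ₈'.ringHomComp (Int.castRingHom ℂ)))⁻¹.ringHomComp
              ι.symm.toRingHom).ringHomComp (algebraMap (PadicAlgCl 2) ℂ_[2]))) *
        (algebraMap ℚ_[2] ℂ_[2] (α⁻¹ ^ (m + 1)) *
          ratMinusTwistedSymbolSum f'
            (((θ * DirichletCharacter.changeLevel h8 (ZMod.χ₈'.ringHomComp (Int.castRingHom ℂ)))⁻¹.ringHomComp
              ι.symm.toRingHom).ringHomComp (algebraMap (PadicAlgCl 2) ℂ_[2])))) := by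
  set ξ := θ * DirichletCharacter.changeLevel h8 (ZMod.χ₈'.ringHomComp (Int.castRingHom ℂ)) with hξ
  have hξprim : ξ.IsPrimitive := isPrimitive_mul_chi8'_changeLevel hm h8 hprim
  obtain ⟨Λ₁, hΛ₁, hΛ₁'⟩ := exists_differentiable_eq_twistedLSeries_holds (f := f) ξ
  obtain ⟨Λ₂, hΛ₂, hΛ₂'⟩ := exists_differentiable_eq_twistedLSeries_holds (f := f') ξ
  have hΛ : Differentiable ℂ (fun s ↦ Λ₁ s * Λ₂ s) := hΛ₁.mul hΛ₂
  have hRS : ∀ s : ℂ, 2 < s.re → (fun s ↦ Λ₁ s * Λ₂ s) s =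
      rankinSelbergEulerProductHecke f
        (baseChangeDirichlet K (ZMod.χ₈'.ringHomComp (Int.castRingHom ℂ)) * baseChangeDirichlet K θ) s := by
    intro s hs
    rw [baseChangeDirichlet_mul_changeLevel K h8 _ θ]
    exact rankinSelberg_baseChangeDirichlet_eq_mul K h2 κ hκ hκ2 hd hf hV' hξprim hΛ₁' hΛ₂' s hs
  have hval := hG.hasLineValueAt (θ := θ) heven (exists_orderOf_eq_two_pow θ) (Or.inl hprim) hΛ hRS
  rwa [chiLineValue_chi8'_of_three_le ι K h2 hsplit 𝔭 𝔭' h𝔭 h𝔭' hf hQ hf' hQ' α Car hm h8 heven hprim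
    hΛ₁ hΛ₁' hΛ₂ hΛ₂'] at hval

end PointwiseMinusEight

end Summit.BirchSwinnertonDyer.BirchSwinnertonDyer.Theorems.PrintCf2.DisegniPairTwo

end
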